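import Literature.AnabelianGeometry.AbsoluteAnabelian.NumberFieldValuationProSet
import HarnessLib

/-!
# Transport of the genuine valuation pro-set `V⊚(F̄/F)` along a field automorphism of `F̄`
# (the consumer side of Neukirch–Uchida for [AbsTopIII] Def 5.1 (ii)'s functoriality `V⊚(−)`)

S. Mochizuki, *Topics in absolute anabelian geometry III* [MochizukiAbsTopIII2015], Def 5.1 (i)–(iii) pp. 113–115
(`V⊚(F̄/F)` with its continuous `G_F`-action, functorial in `Π`; decomposition groups = stabilisers).

The cell's GENUINE instance is `NumberField.valuationProSet F` (abc-iut-L4-d2, `NumberFieldValuationProSet.lean`).  The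
functoriality field `GlobalAnabelianContext.mapProVal` of the §5 interface along an automorphism `α` of `G_F` needs an
`α`-EQUIVARIANT SELF-HOMEOMORPHISM of `V⊚(F̄/F)`.  By Neukirch–Uchida (the cell's open GAP G-L4d2g4-1, non-archimedean
clause; preferred spelling N0: "`α` is conjugation by a field automorphism `τ` of `F̄`: `(α σ)(τ x) = τ(σ x)`") such a
homeomorphism is TRANSPORT BY `τ`.  THIS DEF-BEARING FILE (no `instance`/`notation`; abc-iut-L4-d2) constructs that
transport for ANY ring automorphism `τ : F̄ ≃+* F̄` and proves its equivariance under the N0 relation — so that, once N0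
is typed (abc-iut-w5-d201 «NEUKIRCH-FACT-TYPING») or proved (campaign-L), `mapProVal` at the number-field model is ONE
line:

* `nonArchTransport τ : NonArch F ≃ NonArch F` — `A ↦ τ(A)` (as `A.comap τ⁻¹`), `continuous_nonArchTransport` (patch
  topology: the `x`-coordinate of `τ(A)` is the `τ⁻¹x`-coordinate of `A`);
* `archTransport τ : Arch F ≃ Arch F` — `w ↦ w ∘ τ⁻¹` (Mathlib `InfinitePlace.comap`), `continuous_archTransport`;
* **`transport τ : Carrier F ≃ₜ Carrier F`** — `⊚ ↦ ⊚`, the two transports on `V^non`, `V^arc`; preserves `generic`,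
  `non`, `arc` (`transport_generic`, `image_transport_non`, `image_transport_arc`);
* **`transport_smul`** — if `(α σ) • (τ x) = τ (σ • x)` for all `σ, x` (N0), then
  `transport τ (σ • v) = α σ • transport τ v` for all `σ ∈ G_F`, `v ∈ V⊚(F̄/F)` — the law `mapProVal_smul`.

Classical bookkeeping; nothing here bears on [IUTchIII] Cor. 3.12 or takes a side; Neukirch–Uchida itself is NOT
asserted (it enters only as the hypothesis of `transport_smul`).
-/

noncomputable section

open scoped Pointwise Topology Classical
open NumberField

namespace Literature.AnabelianGeometry.AbsoluteAnabelian.NumberFieldValuationProSet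

open Field

variable (F : Type) [Field F]

/-! ### Non-archimedean local elements -/

/-- `τ⁻¹`-preimage of a proper valuation ring is proper. [cite: MochizukiAbsTopIII2015, Def 5.1 (i) p.113] -/
theorem comap_ne_top {A : ValuationSubring (AlgebraicClosure F)} (hA : A ≠ ⊤)
    (τ : AlgebraicClosure F ≃+* AlgebraicClosure F) :
    A.comap (τ.symm : AlgebraicClosure F →+* AlgebraicClosure F) ≠ ⊤ := by
  intro h
  apply hA
  rw [eq_top_iff]
  intro x _
  have hx : τ x ∈ A.comap (τ.symm : AlgebraicClosure F →+* AlgebraicClosure F) := by rw [h]; trivial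
  rw [ValuationSubring.mem_comap] at hx
  simpa using hx

/-- Transport of a non-trivial valuation ring of `F̄` along `τ`: `A ↦ τ(A) = {x | τ⁻¹ x ∈ A}` (as a function).
[cite: MochizukiAbsTopIII2015, Def 5.1 (i) p.113] -/
def nonArchTransportFun (τ : AlgebraicClosure F ≃+* AlgebraicClosure F) (A : NonArch F) : NonArch F :=
  ⟨A.1.comap (τ.symm : AlgebraicClosure F →+* AlgebraicClosure F), comap_ne_top F A.2 τ⟩

/-- Membership in the transported valuation ring. [cite: MochizukiAbsTopIII2015, Def 5.1 (i) p.113] -/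
theorem mem_nonArchTransportFun_iff (τ : AlgebraicClosure F ≃+* AlgebraicClosure F) (A : NonArch F)
    (x : AlgebraicClosure F) : x ∈ (nonArchTransportFun F τ A).1 ↔ τ.symm x ∈ A.1 :=
  ValuationSubring.mem_comap

/-- Transport along `τ⁻¹` undoes transport along `τ`. [cite: MochizukiAbsTopIII2015, Def 5.1 (i) p.113] -/
theorem nonArchTransportFun_symm_apply (τ : AlgebraicClosure F ≃+* AlgebraicClosure F) (A : NonArch F) :
    nonArchTransportFun F τ.symm (nonArchTransportFun F τ A) = A := by
  apply Subtype.ext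
  ext x
  rw [mem_nonArchTransportFun_iff, mem_nonArchTransportFun_iff]
  simp

/-- **Transport of the non-archimedean local elements along `τ`**, as a bijection.
[cite: MochizukiAbsTopIII2015, Def 5.1 (i) p.113] -/
def nonArchTransport (τ : AlgebraicClosure F ≃+* AlgebraicClosure F) : NonArch F ≃ NonArch F where
  toFun := nonArchTransportFun F τ
  invFun := nonArchTransportFun F τ.symm
  left_inv A := nonArchTransportFun_symm_apply F τ A
  right_inv A := by
    have := nonArchTransportFun_symm_apply F τ.symm A
    rwa [RingEquiv.symm_symm] at this

/-- The transport is continuous for the patch topology. [cite: MochizukiAbsTopIII2015, Def 5.1 (i) p.113] -/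
theorem continuous_nonArchTransport (τ : AlgebraicClosure F ≃+* AlgebraicClosure F) :
    @Continuous (NonArch F) (NonArch F) (nonArchTopology F) (nonArchTopology F) (nonArchTransport F τ) := by
  letI := nonArchTopology F
  have hind : Topology.IsInducing (nonArchChar F) := ⟨rfl⟩
  rw [hind.continuous_iff]
  refine continuous_pi fun x => ?_
  have hfac : (fun A : NonArch F => (nonArchChar F ∘ nonArchTransport F τ) A x) =
      fun A : NonArch F => nonArchChar F A (τ.symm x) := by
    funext A
    simp only [Function.comp, nonArchChar]
    rw [show (x ∈ (nonArchTransport F τ A).1) = (τ.symm x ∈ A.1) from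
      propext (mem_nonArchTransportFun_iff F τ A x)]
  rw [hfac]
  exact (continuous_apply (τ.symm x)).comp hind.continuous

/-- **Transport of the non-archimedean local elements along `τ`**, as a homeomorphism (patch topology).
[cite: MochizukiAbsTopIII2015, Def 5.1 (i) p.113] -/
def nonArchTransportHomeomorph (τ : AlgebraicClosure F ≃+* AlgebraicClosure F) :
    @Homeomorph (NonArch F) (NonArch F) (nonArchTopology F) (nonArchTopology F) :=
  letI := nonArchTopology F
  { nonArchTransport F τ with
    continuous_toFun := continuous_nonArchTransport F τ
    continuous_invFun := continuous_nonArchTransport F τ.symm }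

/-! ### Archimedean local elements -/

/-- Transport of an infinite place of `F̄` along `τ`: `w ↦ w ∘ τ⁻¹`. [cite: MochizukiAbsTopIII2015, Def 5.1 (i) p.113] -/
def archTransport (τ : AlgebraicClosure F ≃+* AlgebraicClosure F) : Arch F ≃ Arch F where
  toFun w := w.comap (τ.symm : AlgebraicClosure F →+* AlgebraicClosure F)
  invFun w := w.comap (τ : AlgebraicClosure F →+* AlgebraicClosure F)
  left_inv w := by
    apply DFunLike.ext
    intro x
    simp [InfinitePlace.comap_apply]
  right_inv w := by
    apply DFunLike.ext
    intro x
    simp [InfinitePlace.comap_apply]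

/-- Value of the transported place. [cite: MochizukiAbsTopIII2015, Def 5.1 (i) p.113] -/
@[simp] theorem archTransport_apply (τ : AlgebraicClosure F ≃+* AlgebraicClosure F) (w : Arch F)
    (x : AlgebraicClosure F) : archTransport F τ w x = w (τ.symm x) := rfl

/-- The transport of infinite places is continuous for the pointwise topology.
[cite: MochizukiAbsTopIII2015, Def 5.1 (i) p.113] -/
theorem continuous_archTransport (τ : AlgebraicClosure F ≃+* AlgebraicClosure F) :
    @Continuous (Arch F) (Arch F) (archTopology F) (archTopology F) (archTransport F τ) := by
  letI := archTopology F
  have hind : Topology.IsInducing (fun w : Arch F => (fun x : AlgebraicClosure F => w x)) := ⟨rfl⟩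
  rw [hind.continuous_iff]
  refine continuous_pi fun x => ?_
  change Continuous (fun w : Arch F => archTransport F τ w x)
  simp only [archTransport_apply]
  exact (continuous_apply (τ.symm x)).comp hind.continuous

/-- **Transport of the archimedean local elements along `τ`**, as a homeomorphism (pointwise topology).
[cite: MochizukiAbsTopIII2015, Def 5.1 (i) p.113] -/
def archTransportHomeomorph (τ : AlgebraicClosure F ≃+* AlgebraicClosure F) :
    @Homeomorph (Arch F) (Arch F) (archTopology F) (archTopology F) :=
  letI := archTopology F
  { archTransport F τ with
    continuous_toFun := continuous_archTransport F τ
    continuous_invFun := by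
      have h := continuous_archTransport F τ.symm
      have hfun : (archTransport F τ).invFun = ⇑(archTransport F τ.symm) := by
        funext w
        rfl
      rw [hfun]
      exact h }

/-! ### The whole pro-set -/

/-- **Transport of `V⊚(F̄/F)` along a field automorphism `τ` of `F̄`**: `⊚ ↦ ⊚`, `A ↦ τ(A)`, `w ↦ w ∘ τ⁻¹` — a
self-homeomorphism of the carrier of `NumberField.valuationProSet F`.
[cite: MochizukiAbsTopIII2015, Def 5.1 (ii) p.114] -/
def transport (τ : AlgebraicClosure F ≃+* AlgebraicClosure F) :
    @Homeomorph (Carrier F) (Carrier F) (carrierTopology F) (carrierTopology F) :=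
  letI := nonArchTopology F
  letI := archTopology F
  Homeomorph.sumCongr (Homeomorph.refl PUnit.{1})
    (Homeomorph.sumCongr (nonArchTransportHomeomorph F τ) (archTransportHomeomorph F τ))

/-- Transport fixes the global element. [cite: MochizukiAbsTopIII2015, Def 5.1 (ii) p.114] -/
theorem transport_generic (τ : AlgebraicClosure F ≃+* AlgebraicClosure F) :
    transport F τ (NumberField.valuationProSet F).generic = (NumberField.valuationProSet F).generic := rfl

/-- Transport on a non-archimedean local element. [cite: MochizukiAbsTopIII2015, Def 5.1 (ii) p.114] -/
theorem transport_inr_inl (τ : AlgebraicClosure F ≃+* AlgebraicClosure F) (A : NonArch F) :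
    transport F τ (Sum.inr (Sum.inl A)) = Sum.inr (Sum.inl (nonArchTransport F τ A)) := rfl

/-- Transport on an archimedean local element. [cite: MochizukiAbsTopIII2015, Def 5.1 (ii) p.114] -/
theorem transport_inr_inr (τ : AlgebraicClosure F ≃+* AlgebraicClosure F) (w : Arch F) :
    transport F τ (Sum.inr (Sum.inr w)) = Sum.inr (Sum.inr (archTransport F τ w)) := rfl

/-- Transport preserves the non-archimedean local elements. [cite: MochizukiAbsTopIII2015, Def 5.1 (ii) p.114] -/
theorem image_transport_non (τ : AlgebraicClosure F ≃+* AlgebraicClosure F) :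
    transport F τ '' (NumberField.valuationProSet F).non = (NumberField.valuationProSet F).non := by
  ext v
  constructor
  · rintro ⟨_, ⟨A, rfl⟩, rfl⟩
    exact ⟨nonArchTransport F τ A, rfl⟩
  · rintro ⟨A, rfl⟩
    exact ⟨Sum.inr (Sum.inl ((nonArchTransport F τ).symm A)), ⟨_, rfl⟩,
      by rw [transport_inr_inl, Equiv.apply_symm_apply]⟩

/-- Transport preserves the archimedean local elements. [cite: MochizukiAbsTopIII2015, Def 5.1 (ii) p.114] -/
theorem image_transport_arc (τ : AlgebraicClosure F ≃+* AlgebraicClosure F) :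
    transport F τ '' (NumberField.valuationProSet F).arc = (NumberField.valuationProSet F).arc := by
  ext v
  constructor
  · rintro ⟨_, ⟨w, rfl⟩, rfl⟩
    exact ⟨archTransport F τ w, rfl⟩
  · rintro ⟨w, rfl⟩
    exact ⟨Sum.inr (Sum.inr ((archTransport F τ).symm w)), ⟨_, rfl⟩,
      by rw [transport_inr_inr, Equiv.apply_symm_apply]⟩

/-! ### Equivariance under the Neukirch–Uchida relation -/

/-- The N0 relation `(α σ) • (τ x) = τ (σ • x)` read backwards: `τ⁻¹ ((α σ) • y) = σ • τ⁻¹ y`.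
[cite: MochizukiAbsTopIII2015, Def 5.1 (ii) p.114] -/
theorem symm_apply_smul_of_rel {α : absoluteGaloisGroup F ≃* absoluteGaloisGroup F}
    {τ : AlgebraicClosure F ≃+* AlgebraicClosure F}
    (hτ : ∀ (σ : absoluteGaloisGroup F) (x : AlgebraicClosure F), (α σ) • (τ x) = τ (σ • x))
    (σ : absoluteGaloisGroup F) (y : AlgebraicClosure F) : τ.symm ((α σ) • y) = σ • τ.symm y := by
  have h := hτ σ (τ.symm y)
  rw [RingEquiv.apply_symm_apply] at h
  rw [h, RingEquiv.symm_apply_apply]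

/-- **Equivariance (the law `mapProVal_smul`)**: if `α` is conjugation by `τ` in the sense of N0 —
`(α σ) • (τ x) = τ (σ • x)` for all `σ ∈ G_F`, `x ∈ F̄` — then transport by `τ` intertwines the `G_F`-action on
`V⊚(F̄/F)` with its `α`-twist: `transport τ (σ • v) = α σ • transport τ v`.
[cite: MochizukiAbsTopIII2015, Def 5.1 (ii) p.114] -/
theorem transport_smul {α : absoluteGaloisGroup F ≃* absoluteGaloisGroup F}
    {τ : AlgebraicClosure F ≃+* AlgebraicClosure F}
    (hτ : ∀ (σ : absoluteGaloisGroup F) (x : AlgebraicClosure F), (α σ) • (τ x) = τ (σ • x))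
    (σ : absoluteGaloisGroup F) (v : Carrier F) :
    (letI := carrierAction F; transport F τ (σ • v) = α σ • transport F τ v) := by
  letI := nonArchAction F
  letI := archAction F
  letI := carrierAction F
  rcases v with u | A | w
  · rfl
  · -- valuation rings: `x ∈ τ(σ • A) ↔ σ⁻¹ • τ⁻¹ x ∈ A ↔ τ⁻¹ ((α σ)⁻¹ • x) ∈ A ↔ x ∈ (α σ) • τ(A)`
    change (Sum.inr (Sum.inl (nonArchTransport F τ (σ • A))) : Carrier F) =
      Sum.inr (Sum.inl ((α σ) • nonArchTransport F τ A))
    congr 2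
    apply Subtype.ext
    ext x
    change x ∈ (nonArchTransportFun F τ ⟨σ • A.1, _⟩).1 ↔ x ∈ (α σ) • (nonArchTransportFun F τ A).1
    rw [mem_nonArchTransportFun_iff, ValuationSubring.mem_pointwise_smul_iff_inv_smul_mem,
      ValuationSubring.mem_pointwise_smul_iff_inv_smul_mem, mem_nonArchTransportFun_iff, ← map_inv,
      symm_apply_smul_of_rel F hτ]
  · -- infinite places: `(w ∘ σ⁻¹ ∘ τ⁻¹) = (w ∘ τ⁻¹) ∘ (α σ)⁻¹`
    change (Sum.inr (Sum.inr (archTransport F τ (σ • w))) : Carrier F) =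
      Sum.inr (Sum.inr ((α σ) • archTransport F τ w))
    congr 2
    apply DFunLike.ext
    intro x
    rw [archTransport_apply, archAction_smul_apply, archAction_smul_apply, archTransport_apply, ← map_inv,
      symm_apply_smul_of_rel F hτ]

end Literature.AnabelianGeometry.AbsoluteAnabelian.NumberFieldValuationProSet

end
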